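import Summits.Schanuel.Schanuel.Theses.RoyCriterion
import Summits.Schanuel.Schanuel.Theorems.RoyCriterionAssembly

/-!
# Schanuel / RoyCriterion — `Assembly` (item `stmt-Schanuel-0079`): the route declaration, by name

Route `Schanuel/RoyCriterion`, assembly item `stmt-Schanuel-0079` (`roy_assembly`; route declaration
`Summit.Schanuel.Schanuel.Theses.RoyCriterion.Assembly`, which unfolds to
`Roy2001_iff → (∀ n, RoyCriterion n) → Schanuel`). Roy (Acta Arith. 97 (2001), §1, Thm 1 and §5)
proves `RoyCriterion l ↔ SchanuelRank l` for every rank `l`; with that equivalence taken as the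
hypothesis `Literature.NumberTheory.Transcendental.Roy2001_iff`, Roy's arithmetic criterion for
every rank gives Schanuel's conjecture, because `Schanuel` unfolds to `∀ l, SchanuelRank l`
verbatim — one application of `Iff.mp` per rank. That term is already in tree as
`Literature.Transcend.roy2001_iff_imp_royCriterion_imp_schanuel`
(`Theorems/RoyCriterionAssembly.lean`, whose statement is the unfolded form); this file restates it
against the route declaration BY NAME so that the gate can close the item.

Design note: this is a separate file rather than an appendix to `Theorems/RoyCriterionAssembly.lean`
because the gate's append-only record of that file predates the 2026-08-14 namespace alignment (its
recorded statements use the pre-alignment short names), so any whole-file resubmission of it is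
bounced `theorems.append-only` although the tree copy is byte-identical. Not here: the
exact-signature twin `Assembly2` (item `stmt-Schanuel-0464`), a separate item.
-/

-- single-conjunct summit: `Summit.Schanuel.Schanuel.…` is the mandated namespace (CONVENTIONS §1–2,
-- D-0017); without this option `linter.dupNamespace` warns on every declaration below.
set_option linter.dupNamespace false

namespace Summit.Schanuel.Schanuel.Theorems.RoyCriterion

/-- Settles `stmt-Schanuel-0079` (assembly of route `RoyCriterion`): the route declaration
`Summit.Schanuel.Schanuel.Theses.RoyCriterion.Assembly` holds — Roy's equivalence
`Roy2001_iff : ∀ l, RoyCriterion l ↔ SchanuelRank l` (Roy 2001, §1 + Thm 1 + §5, taken as the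
hypothesis) and Roy's criterion for every rank give Schanuel's conjecture, since `Schanuel` unfolds
to `∀ l, SchanuelRank l`. Term: `Literature.Transcend.roy2001_iff_imp_royCriterion_imp_schanuel`.
[folklore] -/
theorem Assembly_proof :
    Summit.Schanuel.Schanuel.Theses.RoyCriterion.Assembly := by
  unfold Summit.Schanuel.Schanuel.Theses.RoyCriterion.Assembly
  exact Literature.Transcend.roy2001_iff_imp_royCriterion_imp_schanuel

end Summit.Schanuel.Schanuel.Theorems.RoyCriterion
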